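import Summits.CriticalPhenomena.PercolationContinuityZ3.Theorems.Transplant.SkelPhiNegReachRoomsRead
import Summits.CriticalPhenomena.PercolationContinuityZ3.Theorems.Transplant.SkelPhiNegReachRooms
import Summits.CriticalPhenomena.PercolationContinuityZ3.Theorems.Transplant.KNParaChainCorridorSN
import Summits.CriticalPhenomena.PercolationContinuityZ3.Theorems.Transplant.SkelPhiRunQSteps
import Summits.CriticalPhenomena.PercolationContinuityZ3.Theorems.Transplant.SkelPhiParaRunChain
import Summits.CriticalPhenomena.PercolationContinuityZ3.Theorems.Transplant.SkelPhiWinChainF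
import HarnessLib

/-!
# N1 (the `{±1}` node), (C) column file (C-A5): THE TRUE TARGETS OF THE (C) CORRIDOR ARE NONEMPTY — a vertex of the fresh habitat over every core.
# §1 the planar cube room `PCells2.mem_Q_of_lev`; §2 **the habitat membership device for the fine map** `Skelφ.mem_Q_union_HfullSpan₂` (WEAK steps +
# `Lip`: a vertex whose fine footprint has level in `[−5r∥ + 1, 22r∥ − 1]` and transverse margin `2r⊥ − 1`, at depth `D` with `D + 1 ≤ Λ.rQ α y` and
# `D + 1 ≤ Λ.ρ a' y du ℓ`, lies in the cube span `Q_α(y)` or the corridor span `H^{a'}_{y,du}` — some neighbour shares its window); §3 the segment-1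
# targets (`coreTF₁_nonempty`: the frame-change vertex `c₀`, `F c₀ = cen y`, lies in every rounds' core); §4 the segment-2 targets
# (`coreTF₂_nonempty`: `c₀` for the u-rounds' cores and the band's start box; for the band's cores `j ≥ 1` a habitat vertex with run reading in the
# core, SUPPLIED — and `exists_mem_span_runX_eq`: such a vertex from p1's run quasi-steps `qStepsN_runX` (`|h| ≤ k·n`) at any run point `z` whose
# fine reading (the `rdLo/rdHi` vectors of (C-A4) at the degenerate box `[z, z]`) has the margins of §2 and whose cost `(k+3)‖z‖₁` fits the depths).

builds on p205010 (kernel theorem, internal audit signed; external expert review pending) — nothing in this file uses p205010; nothing here is a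
claim about the open node `SamePDropOfSkeletonNeg`.
Lane `prim-bschramm`, seat `prim-bschramm-p5` (gen 8; (C) lineage); helper file (`--supports stmt-CriticalPhenomena-4575`).
[cite: KozmaNitzan2024, §4 p. 26 ((29): the column vertex), Lemma 12 (pp. 23–25)] [cite: MartineauTassion2017, §4.3]
-/

noncomputable section

open scoped Classical

namespace Summit.CriticalPhenomena.PercolationContinuityZ3.Theorems

namespace Transplant

open Literature.Probability.Percolation Literature.Probability.LatticeModels SimpleGraph GadgetSystem Contour KNCells
open Literature.Probability.Percolation.KozmaNitzan
open Literature.Probability.Percolation.KozmaNitzan.Cells (oth oth_ne sgOf sgOf_sign stepVec_apply_fst eq_oth_of_ne)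
open Literature.Barriers.CriticalPhenomena (graphBall mem_graphBall_self graphBall_mono)
open BoxProdZ2 (ConcRadiiG mem_graphBall_succ_of_adj)
open PlanarSkeletonConc (mem_vspan_edgesIn_of_adj)
open PCells (mem_psBox_iff)

/-! ## §1 The planar cube room -/

namespace PCells2

variable (P : PCells2) {y : Site 2} {du : MDir} {z : Site 2}

/-- **`z ∈ Q_y`** from `−5r∥ ≤ lev ≤ 5r∥` and `|z⊥ − cen⊥| ≤ 2r⊥`. [cite: KozmaNitzan2024, §4 p. 26 (Q_v)] -/
theorem mem_Q_of_lev (h1 : -(5 * (P.r du.1 : ℤ)) ≤ P.lev du y z) (h2 : P.lev du y z ≤ 5 * (P.r du.1 : ℤ))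
    (h3 : P.cen y (oth du.1) - 2 * (P.r (oth du.1) : ℤ) ≤ z (oth du.1)) (h4 : z (oth du.1) ≤ P.cen y (oth du.1) + 2 * (P.r (oth du.1) : ℤ)) :
    z ∈ P.Q y := by
  rw [Q, mem_abox_iff]
  intro i
  push_cast
  by_cases hi : i = du.1
  · subst hi
    rw [lev_def] at h1 h2
    rcases sgOf_sign du with hs | hs <;> rw [hs] at h1 h2 <;> constructor <;> linarith
  · rw [eq_oth_of_ne hi]
    constructor <;> linarith [Int.natCast_nonneg (P.r (oth du.1))]

end PCells2

namespace Skelφ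

open TwoAxis.Para (modulus)
open ChainPlanar ChainPara

variable {V : Type} [DecidableEq V] {G : SimpleGraph V} [G.LocallyFinite] {F : V → Site 2}

/-! ## §2 The habitat membership device for the fine map (weak steps) -/

/-- **A vertex whose fine footprint has a margin inside `Q_y ∪ H_{y,du}`, deep enough, lies in the cube span `Q_α(y)` or in the corridor span
`H^{a'}_{y,du}`** of `cellGeomSG₂ G F P w₀ Λ`: by weak steps it has a neighbour, by `Lip` the neighbour's footprint is within one cell, and the two
footprints lie together in `P.Q y` (levels `≤ 5r∥`) or together in `P.Hfull y du` (levels `≥ 5r∥`). [cite: KozmaNitzan2024, §4 p. 26 ((29))] -/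
theorem mem_Q_union_HfullSpan₂ (hlip : Lip G F) (hws : WeakSteps G F) {P : PCells2} {w₀ : V} {Λ : ConcRadiiG} {α a' : ℕ} {y : Site 2} {du : MDir}
    {g : V} {Dg : ℕ} (hg : g ∈ graphBall G w₀ Dg) (hDQ : Dg + 1 ≤ Λ.rQ α y) (hDρ : ∀ ℓ, Dg + 1 ≤ Λ.ρ a' y du ℓ)
    (h1 : -(5 * (P.r du.1 : ℤ)) + 1 ≤ P.lev du y (F g)) (h2 : P.lev du y (F g) ≤ 22 * (P.r du.1 : ℤ) - 1)
    (h3 : P.cen y (oth du.1) - 2 * (P.r (oth du.1) : ℤ) + 1 ≤ F g (oth du.1)) (h4 : F g (oth du.1) ≤ P.cen y (oth du.1) + 2 * (P.r (oth du.1) : ℤ) - 1) :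
    g ∈ (cellGeomSG₂ G F P w₀ Λ).Q α y ∪ (faceDataSG G F P w₀ Λ).Hfull a' y du := by
  obtain ⟨g', hadj, -⟩ := hws g 0 1
  have hg' : g' ∈ graphBall G w₀ (Dg + 1) := mem_graphBall_succ_of_adj G hg hadj
  have hgD : g ∈ graphBall G w₀ (Dg + 1) := graphBall_mono G w₀ (Nat.le_succ _) hg
  have hL := hlip hadj
  have hpar := abs_le.1 (hL du.1)
  have hperp := abs_le.1 (hL (oth du.1))
  -- the neighbour's level and transverse coordinate
  have hlev' : P.lev du y (F g) - 1 ≤ P.lev du y (F g') ∧ P.lev du y (F g') ≤ P.lev du y (F g) + 1 := by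
    rw [PCells2.lev_def, PCells2.lev_def]
    rcases sgOf_sign du with hs | hs <;> rw [hs] <;> constructor <;> linarith
  have h3' : P.cen y (oth du.1) - 2 * (P.r (oth du.1) : ℤ) ≤ F g' (oth du.1) := by linarith
  have h4' : F g' (oth du.1) ≤ P.cen y (oth du.1) + 2 * (P.r (oth du.1) : ℤ) := by linarith
  by_cases hc : P.lev du y (F g) ≤ 5 * (P.r du.1 : ℤ) ∧ P.lev du y (F g') ≤ 5 * (P.r du.1 : ℤ)
  · -- both footprints in the cube
    refine Finset.mem_union_left _ ?_
    have hgQ : F g ∈ P.Q y := P.mem_Q_of_lev (by linarith) hc.1 (by linarith) (by linarith)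
    have hg'Q : F g' ∈ P.Q y := P.mem_Q_of_lev (by linarith [hlev'.1]) hc.2 h3' h4'
    change g ∈ VWin G F w₀ (P.Q y) (Λ.rQ α y)
    exact (mem_vspan_edgesIn_of_adj ((mem_Win G F).2 ⟨graphBall_mono G w₀ hDQ hgD, hgQ⟩)
      ((mem_Win G F).2 ⟨graphBall_mono G w₀ hDQ hg', hg'Q⟩) hadj).1
  · -- both footprints in the corridor
    refine Finset.mem_union_right _ ?_
    have hmin : 5 * (P.r du.1 : ℤ) ≤ P.lev du y (F g) ∧ 5 * (P.r du.1 : ℤ) ≤ P.lev du y (F g') := by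
      rw [not_and_or] at hc
      rcases hc with hc | hc <;> push Not at hc <;> constructor <;> linarith [hlev'.1, hlev'.2]
    have hgH : F g ∈ P.Hfull y du := P.mem_Hfull_of_lev hmin.1 (by linarith) (by linarith) (by linarith)
    have hg'H : F g' ∈ P.Hfull y du := P.mem_Hfull_of_lev hmin.2 (by linarith [hlev'.2]) h3' h4'
    change g ∈ VStair G F w₀ (P.Hfull y du) (prof P Λ a' y du)
    refine (mem_vspan_edgesIn_of_adj ?_ ?_ hadj).1
    · exact mem_stair.2 ⟨hgH, graphBall_mono G w₀ (by unfold prof; exact hDρ _) hgD⟩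
    · exact mem_stair.2 ⟨hg'H, graphBall_mono G w₀ (by unfold prof; exact hDρ _) hg'⟩

/-- The cube span and the corridor span lie in the fresh habitat `E^{α}_{x,y} ∪ H^{a'}_{y,du}` (`y = tgt e`). [folklore] -/
theorem Q_union_HfullSpan_subset_habΩ₂ {P : PCells2} {w₀ : V} {Λ : ConcRadiiG} {α a' : ℕ} {e : Site 2 × MDir} {du : MDir} :
    (cellGeomSG₂ G F P w₀ Λ).Q α (tgt e) ∪ (faceDataSG G F P w₀ Λ).Hfull a' (tgt e) du ⊆
      (cellGeomSG₂ G F P w₀ Λ).Ewv α e.1 e.2 ∪ (faceDataSG G F P w₀ Λ).Hfull a' (tgt e) du := by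
  intro g hg
  rcases Finset.mem_union.1 hg with hg | hg
  · exact Finset.mem_union_left _ (Finset.mem_union_right _ hg)
  · exact Finset.mem_union_right _ hg

/-! ## §3 Nonempty true targets: a habitat vertex reading inside every core -/

/-- A habitat vertex reading inside the next core makes the true target nonempty. [folklore] -/
theorem coreTF_nonempty_of_mem {ρ : V → Site 2} (hlip : Lip G ρ) {Ω : Finset V} {S : SchedFrame} {k : ℕ} {g : V} (hg : g ∈ Ω)
    (hρ : ρ g ∈ S.core (k + 1)) : ((planarWindowIn hlip Ω).coreTF S k).Nonempty :=
  ⟨g, by rw [PlanarWindow.coreTF, planarWindowIn_W, mem_WinIn]; exact ⟨hg, hρ⟩⟩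

/-- **Segment 1: the frame-change vertex lies in every rounds' core** (`F c₀ = cen y`, the cores are boxes about `cen y`). [folklore] -/
theorem coreTF₁_nonempty (hlip : Lip G F) {Ω : Finset V} {P : PCells2} {y : Site 2} (P₁ : LocPrm) (hP₁ : LocOK P₁) (z : ℕ) {c₀ : V}
    (hc₀Ω : c₀ ∈ Ω) (hc₀ : F c₀ = P.cen y) (k : ℕ) :
    ((planarWindowIn hlip Ω).coreTF (P₁.scheduleNz 1 (P.cen y) hP₁ z).toFrame k).Nonempty := by
  refine coreTF_nonempty_of_mem hlip hc₀Ω ?_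
  show F c₀ ∈ (P₁.scheduleNz 1 (P.cen y) hP₁ z).core (k + 1)
  rw [LocPrm.scheduleNz_core, LocPrm.mem_pcore_iff, hc₀]
  simp only [sub_self]
  exact ⟨LocPrm.L_nonneg hP₁ _, P₁.Wk_nonneg _⟩

/-- **Segment 2: the u-rounds' cores and the band's start box contain the base reading `0 = R c₀`; the band's cores `j ≥ 1` are SUPPLIED a habitat
vertex** (`hzB`, from `exists_mem_span_runX_eq`). [cite: KozmaNitzan2024, §4 Lemma 12 (pp. 23–25)] -/
theorem coreTF₂_nonempty {φ : V → Site 2} {c₀ : V} {n : ℕ} {h : ℤ} (hlipR : Lip G (runX φ c₀ n h 1)) {Ω : Finset V} (hc₀Ω : c₀ ∈ Ω)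
    (P₂ : LocPrm) (hP₂ : LocOK P₂) (B : RunPrm) (aB : Fin 2) {σB : ℤ} (hσB : σB = 1 ∨ σB = -1) (hB : RunOK B) (heb : B.eb = B.ea)
    (hR' : B.ea = P₂.e) (hjoin : (P₂.scheduleN 0 0 hP₂).core (P₂.N + 1) ⊆ (B.scheduleN aB hσB 0 hB heb).core 0)
    (hreg : (B.scheduleN aB hσB 0 hB heb).core 0 ⊆ (P₂.scheduleN 0 0 hP₂).region P₂.N)
    (hzB : ∀ j, 1 ≤ j → j ≤ B.N + 1 → ∃ g ∈ Ω, runX φ c₀ n h 1 g ∈ B.pcore aB σB 0 j) {k : ℕ}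
    (hk : k ≤ (corrRunSchedS P₂ hP₂ B aB hσB hB heb hR' hjoin hreg).N) :
    ((planarWindowIn hlipR Ω).coreTF (corrRunSchedS P₂ hP₂ B aB hσB hB heb hR' hjoin hreg).toFrame k).Nonempty := by
  have hN : (corrRunSchedS P₂ hP₂ B aB hσB hB heb hR' hjoin hreg).N = P₂.N + 1 + B.N := rfl
  have h0 := runX_origin φ c₀ n h (1 : ℤ)
  by_cases hk₁ : k + 1 ≤ P₂.N
  · -- a u-rounds' core: contains `0`
    refine coreTF_nonempty_of_mem hlipR hc₀Ω ?_
    show runX φ c₀ n h 1 c₀ ∈ (corrRunSchedS P₂ hP₂ B aB hσB hB heb hR' hjoin hreg).core (k + 1)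
    rw [(corrRunSchedS_left P₂ hP₂ B aB hσB hB heb hR' hjoin hreg hk₁).2.2, h0, LocPrm.mem_pcore_iff]
    simp only [Pi.zero_apply, sub_self]
    exact ⟨LocPrm.L_nonneg hP₂ _, P₂.Wk_nonneg _⟩
  · push Not at hk₁
    obtain ⟨j, hj⟩ : ∃ j, k + 1 = P₂.N + 1 + j := ⟨k + 1 - (P₂.N + 1), by omega⟩
    have hjN : j ≤ B.N + 1 := by rw [hN] at hk; omega
    by_cases hj0 : j = 0
    · -- the band's start box: contains `0`
      subst hj0
      refine coreTF_nonempty_of_mem hlipR hc₀Ω ?_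
      show runX φ c₀ n h 1 c₀ ∈ (corrRunSchedS P₂ hP₂ B aB hσB hB heb hR' hjoin hreg).core (k + 1)
      rw [hj, (corrRunSchedS_right P₂ hP₂ B aB hσB hB heb hR' hjoin hreg 0).2.2, h0, RunPrm.mem_pcore_iff hσB, RunPrm.inCore_zero_iff]
      simp only [Pi.zero_apply, sub_self, mul_zero]
      refine ⟨by linarith [Int.natCast_nonneg B.q], Int.natCast_nonneg B.q, by linarith [Int.natCast_nonneg B.Wm], Int.natCast_nonneg B.Wp⟩
    · obtain ⟨g, hgΩ, hg⟩ := hzB j (by omega) hjN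
      refine coreTF_nonempty_of_mem hlipR hgΩ ?_
      show runX φ c₀ n h 1 g ∈ (corrRunSchedS P₂ hP₂ B aB hσB hB heb hR' hjoin hreg).core (k + 1)
      rw [hj, (corrRunSchedS_right P₂ hP₂ B aB hσB hB heb hR' hjoin hreg j).2.2]
      exact hg

/-! ## §4 The band's habitat vertices from the run quasi-steps -/

/-- **A habitat vertex with a prescribed run reading**: under the skeleton's unit steps and `|h| ≤ k·n`, the run frame `runX φ c₀ n h 1` has quasi-steps
of cost `k + 3` (p1), so every run point `z` is read at a vertex `g` within `(k+3)‖z‖₁` of `c₀`; if the fine reading of the point box `[z, z]` has the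
margins of `mem_Q_union_HfullSpan₂` and the depth fits, `g` lies in `Q_α(y) ∪ H^{a'}_{y,du}`. [cite: KozmaNitzan2024, §4 p. 26 ((29))] -/
theorem exists_mem_span_runX_eq {φ : V → Site 2} (hstep : Steps G φ) {t₀ c₀ : V} {A : ℤ} (hA : 0 ≤ A) {n : ℕ} (hn : 1 ≤ n) {h vα vβ : ℤ}
    (hm : 0 ≤ modulus n h vα vβ) {c₀' c₁' s₀ s₁ D : ℤ} (hc₀' : 0 ≤ c₀') (hc₁' : 0 ≤ c₁') (hD : 0 < D) {kq : ℕ} (hκ : h.natAbs ≤ kq * n)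
    (hlipF : Lip G (fineSkel φ t₀ A n h vα vβ c₀' c₁' s₀ s₁ D)) (hws : WeakSteps G (fineSkel φ t₀ A n h vα vβ c₀' c₁' s₀ s₁ D))
    {P : PCells2} {Λ : ConcRadiiG} {α a' : ℕ} {y : Site 2} {du : MDir} (hcen : fineSkel φ t₀ A n h vα vβ c₀' c₁' s₀ s₁ D c₀ = P.cen y)
    {D₀ : ℕ} (hc₀ : c₀ ∈ graphBall G t₀ D₀) (z : Site 2)
    (hDQ : D₀ + (kq + 3) * ((z 0).natAbs + (z 1).natAbs) + 1 ≤ Λ.rQ α y)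
    (hDρ : ∀ ℓ, D₀ + (kq + 3) * ((z 0).natAbs + (z 1).natAbs) + 1 ≤ Λ.ρ a' y du ℓ)
    (hl₁ : sgOf du = 1 → -(5 * (P.r du.1 : ℤ)) + 1 ≤ rdLo A n h vα vβ c₀' c₁' D z z du.1 ∧ rdHi A n h vα vβ c₀' c₁' D z z du.1 ≤ 22 * (P.r du.1 : ℤ) - 1)
    (hl₂ : sgOf du = -1 → -(5 * (P.r du.1 : ℤ)) + 1 ≤ -rdHi A n h vα vβ c₀' c₁' D z z du.1 ∧ -rdLo A n h vα vβ c₀' c₁' D z z du.1 ≤ 22 * (P.r du.1 : ℤ) - 1)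
    (ht : -(2 * (P.r (oth du.1) : ℤ)) + 1 ≤ rdLo A n h vα vβ c₀' c₁' D z z (oth du.1) ∧
      rdHi A n h vα vβ c₀' c₁' D z z (oth du.1) ≤ 2 * (P.r (oth du.1) : ℤ) - 1) :
    ∃ g ∈ (cellGeomSG₂ G (fineSkel φ t₀ A n h vα vβ c₀' c₁' s₀ s₁ D) P t₀ Λ).Q α y ∪
        (faceDataSG G (fineSkel φ t₀ A n h vα vβ c₀' c₁' s₀ s₁ D) P t₀ Λ).Hfull a' y du,
      runX φ c₀ n h 1 g = z := by
  obtain ⟨g, hg, hgz⟩ := QStepsN.exists_mem_graphBall_eq (qStepsN_runX hstep hn c₀ h (Or.inl rfl) hκ) c₀ z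
  rw [runX_origin] at hg
  simp only [Pi.zero_apply, sub_zero] at hg
  have hgt : g ∈ graphBall G t₀ (D₀ + (kq + 3) * ((z 0).natAbs + (z 1).natAbs)) := BoxProdZ2.mem_graphBall_add G hc₀ hg
  have hv : runX φ c₀ n h 1 g ∈ Finset.Icc z z := by rw [hgz]; exact Finset.mem_Icc.2 ⟨le_rfl, le_rfl⟩
  have hpar := fine_sub_cen_mem_rd hA hn hm hc₀' hc₁' hD hcen hv du.1
  have hperp := fine_sub_cen_mem_rd hA hn hm hc₀' hc₁' hD hcen hv (oth du.1)
  refine ⟨g, mem_Q_union_HfullSpan₂ hlipF hws hgt hDQ hDρ ?_ ?_ (by linarith [hperp.1, ht.1]) (by linarith [hperp.2, ht.2]), hgz⟩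
  · rw [PCells2.lev_def]
    rcases sgOf_sign du with hs | hs <;> rw [hs]
    · have := (hl₁ hs).1; linarith [hpar.1]
    · have := (hl₂ hs).1; linarith [hpar.2]
  · rw [PCells2.lev_def]
    rcases sgOf_sign du with hs | hs <;> rw [hs]
    · have := (hl₁ hs).2; linarith [hpar.2]
    · have := (hl₂ hs).2; linarith [hpar.1]

end Skelφ

end Transplant

end Summit.CriticalPhenomena.PercolationContinuityZ3.Theorems

end
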